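import Literature.Geometry.Lorentzian.KerrMiddleRegionEnergyBoundedness
import Literature.Geometry.Lorentzian.KerrHorizonRegularBoundednessAssembly
import Literature.Geometry.Lorentzian.KerrDecayHierarchyProofs
import HarnessLib

/-!
# Energy boundedness for horizon-regular solutions of the Kerr wave equation: the reduction of the
# named fact to the phase-space inputs of Dafermos–Rodnianski–Shlapentokh-Rothman §§5–12

(family `gr`; namespace `Literature.Geometry.Lorentzian`; written from the proving seat of the named
fact `DafermosRodnianskiShlapentokhRothman2016_energyBoundedness_horizonRegular`
(`KerrHorizonRegularWaveBoundedness.lean`); no definitions, no named facts (D-0026).)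

The proof of (23) of Theorem 3.1 of arXiv:1402.7034 for the horizon-regular class (§3.3 form) is
organised in this library as follows (every arrow is a theorem of the library):

* named fact ⇐ (23) for ONE admissible foliation `{t* = τ + F₀}`
  (`…_of_exists`, `KerrHorizonRegularWaveBoundednessReduction.lean`: DR Prop. 4.6.1);
* (23) for one foliation ⇐ (i) integrated energy decay on a near-horizon shell, (ii) on a far shell,
  (iii) boundedness on the middle region (`…_of_shellDecay_of_middleBound`,
  `KerrHorizonRegularBoundednessAssembly.lean`: §13.2–§13.3 with the red-shift estimate
  Prop. 4.5.2 and the `χT` estimate);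
* (iii) ⇐ a trapped-frequency decomposition of the solution in the middle slab with the bounds
  (P1), (P3)–(P6) (`kerr_horizonRegular_middleBound_of_trappedDecomposition`,
  `KerrMiddleRegionEnergyBoundedness.lean`: §13.1, Props. 13.1.1–13.1.2 with the energy identity of
  the vector fields `V_i`, `KerrShellKillingEnergyEstimate.lean`).

This file composes the last two arrows:
`DafermosRodnianskiShlapentokhRothman2016_energyBoundedness_horizonRegular_of_shellDecay_of_trappedDecomposition`
— the named fact follows from (i), (ii) and the existence, for arbitrarily fine shell partitions,
of trapped-frequency decompositions with (P1), (P3)–(P6), for one admissible foliation — and then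
removes (i), (ii): a collar inside the region of (P1) met by none of the shells inherits integrated
energy decay from (P4) (`kerr_graphSlice_collarDecay_of_trappedDecomposition`, §13.2 read off from
the pieces), whence
`DafermosRodnianskiShlapentokhRothman2016_energyBoundedness_horizonRegular_of_trappedDecomposition`:
the named fact follows from the existence of the trapped-frequency decompositions ALONE (shells
inside `[r₊ + η, R₁]`, (P1) on `{r₊ + η/4 < r < R₂ + 1}`); finally `…_of_trappedDecomposition_spacetime`
is the same statement with (P3)–(P5) written as space-time integrals over `D⁺(Σ̃_0) = {t* > F}`
(`kerr_lintegral_Ioi_lintegral_leaf_eq`: the leaves `Σ̃_s`, `s > 0`, sweep `{t* > F}` with Jacobian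
`1`, `Kerr.lintegral_lintegral_leafPoint_eq`). What is
left is exactly the phase-space theory of §§5–12 of loc. cit. (Carter's separation with
Plancherel, the frequency-localised multiplier estimates of §8 with the quantitative mode
stability of Shlapentokh-Rothman, the summation of §9, the continuity argument of §11 and the
precise integrated local energy decay Prop. 12.1), which is NOT in this library.

## References

* M. Dafermos, I. Rodnianski, Y. Shlapentokh-Rothman, *Decay for solutions of the wave equation on
  Kerr exterior spacetimes III: the full subextremal case `|a| < M`*, Ann. of Math. 183 (2016)
  787–913, arXiv:1402.7034: Thm. 3.1 (23), §3.3, §13 (key `DafermosRodnianskiShlapentokhrothman2014`).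
-/

noncomputable section

open Set Filter Metric MeasureTheory
open scoped Topology Manifold ContDiff ENNReal

namespace Literature.Geometry.Lorentzian

/-! ## Glue: the named fact from shell decay and trapped-frequency decompositions -/

/-- **Energy boundedness for horizon-regular solutions from the phase-space inputs of
Dafermos–Rodnianski–Shlapentokh-Rothman** (arXiv:1402.7034, Thm. 3.1 (23), §3.3 form, horizon-
regular class): the named fact `DafermosRodnianskiShlapentokhRothman2016_energyBoundedness_horizonRegular`
follows once, for every subextremal `(M, a)` and `r₋ < r₀ < r₊` and every `η₀ > 0`, there are a
collar width `0 < η ≤ η₀`, radii `2M < R₁ < R₂` and ONE admissible height `F` with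
(i) integrated decay of the energy on the near shell `{r₊ + η/2 ≤ r ≤ r₊ + η}` and (ii) on the far
shell `{R₁ ≤ r ≤ R₂}` ((20) of Thm. 3.1 on shells off the trapped set), and (iii') for every
`ε₀ > 0` an `ε₀`-fine finite family of radial shells in `[r₊ + η/4, R₂ + 1]` and `B < ∞` such that
every horizon-regular solution admits a trapped-frequency decomposition `(w_i)` adapted to these
shells with the bounds (P1), (P3)–(P6) of `kerr_horizonRegular_middleBound_of_trappedDecomposition`
(Def. 13.1.2 with (notCrudeILED), Plancherel and the support of the sources `F̃_i`). Composition of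
`kerr_horizonRegular_middleBound_of_trappedDecomposition` (Prop. 13.1.2) with the §13.3 assembly
`DafermosRodnianskiShlapentokhRothman2016_energyBoundedness_horizonRegular_of_shellDecay_of_middleBound`.
The hypotheses are the phase-space theory of §§5–12 of loc. cit.; they are NOT proved in this
library. [cite: DafermosRodnianskiShlapentokhrothman2014, Thm. 3.1 (23), §13] -/
theorem DafermosRodnianskiShlapentokhRothman2016_energyBoundedness_horizonRegular_of_shellDecay_of_trappedDecomposition
    (h : ∀ [Kerr.Facts] [Kerr.SliceFacts] (M a r₀ : ℝ) (hr : r₀ < Kerr.rPlus M a),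
      Kerr.IsSubextremal M a → Kerr.rMinus M a < r₀ → ∀ η₀ : ℝ, 0 < η₀ →
      ∃ η : ℝ, 0 < η ∧ η ≤ η₀ ∧ ∃ R₁ R₂ : ℝ, 2 * M < R₁ ∧ R₁ < R₂ ∧
      ∃ F : E3 → ℝ, Kerr.IsAdmissibleHeight M F ∧
          (∃ B : ℝ≥0∞, B < ⊤ ∧ ∀ ψ : Kerr.region a r₀ → ℝ,
          ContMDiff 𝓘(ℝ, E4) 𝓘(ℝ, ℝ) ∞ ψ →
          (∀ x : Kerr.region a r₀, Kerr.rPlus M a < Kerr.radius a (x : E4) →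
            (Kerr.smoothMetric M a r₀).toPseudoRiemannianMetric.dalembertian ψ x = 0) →
          (∃ ρ : ℝ, ∀ x : Kerr.region a r₀, (x : E4) 0 = F (E4.spatial (x : E4)) →
              ρ < E4.spatialNorm (x : E4) → ψ x = 0 ∧ mfderiv 𝓘(ℝ, E4) 𝓘(ℝ, ℝ) ψ x = 0) →
          ∀ τ : ℝ, 0 ≤ τ →
            ∫⁻ u in Set.Ioc 0 τ, graphSliceEnergyOn (Kerr.exterior M a)
                (fun y : Kerr.exterior M a ↦ ψ ⟨(y : E4), Kerr.region_mono a hr.le y.2⟩) F u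
                {y | Kerr.rPlus M a + η / 2 ≤ Kerr.radius a (E4.ofTimeSpace (u + F y) y) ∧
                  Kerr.radius a (E4.ofTimeSpace (u + F y) y) ≤ Kerr.rPlus M a + η} ≤
              B * graphSliceEnergy (Kerr.exterior M a)
                (fun y : Kerr.exterior M a ↦ ψ ⟨(y : E4), Kerr.region_mono a hr.le y.2⟩) F 0) ∧
          (∃ B : ℝ≥0∞, B < ⊤ ∧ ∀ ψ : Kerr.region a r₀ → ℝ,
          ContMDiff 𝓘(ℝ, E4) 𝓘(ℝ, ℝ) ∞ ψ →
          (∀ x : Kerr.region a r₀, Kerr.rPlus M a < Kerr.radius a (x : E4) →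
            (Kerr.smoothMetric M a r₀).toPseudoRiemannianMetric.dalembertian ψ x = 0) →
          (∃ ρ : ℝ, ∀ x : Kerr.region a r₀, (x : E4) 0 = F (E4.spatial (x : E4)) →
              ρ < E4.spatialNorm (x : E4) → ψ x = 0 ∧ mfderiv 𝓘(ℝ, E4) 𝓘(ℝ, ℝ) ψ x = 0) →
          ∀ τ : ℝ, 0 ≤ τ →
            ∫⁻ u in Set.Ioc 0 τ, graphSliceEnergyOn (Kerr.exterior M a)
                (fun y : Kerr.exterior M a ↦ ψ ⟨(y : E4), Kerr.region_mono a hr.le y.2⟩) F u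
                {y | R₁ ≤ Kerr.radius a (E4.ofTimeSpace (u + F y) y) ∧
                  Kerr.radius a (E4.ofTimeSpace (u + F y) y) ≤ R₂} ≤
              B * graphSliceEnergy (Kerr.exterior M a)
                (fun y : Kerr.exterior M a ↦ ψ ⟨(y : E4), Kerr.region_mono a hr.le y.2⟩) F 0) ∧
          (∀ ε₀ : ℝ, 0 < ε₀ → ∃ (m : ℕ) (lo hi : Fin m → ℝ),
            (∀ i, Kerr.rPlus M a + η / 4 ≤ lo i ∧ lo i ≤ hi i ∧ hi i ≤ R₂ + 1 ∧ hi i - lo i ≤ ε₀) ∧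
            ∃ B : ℝ≥0∞, B < ⊤ ∧ ∀ ψ : Kerr.region a r₀ → ℝ,
            ContMDiff 𝓘(ℝ, E4) 𝓘(ℝ, ℝ) ∞ ψ →
            (∀ x : Kerr.region a r₀, Kerr.rPlus M a < Kerr.radius a (x : E4) →
              (Kerr.smoothMetric M a r₀).toPseudoRiemannianMetric.dalembertian ψ x = 0) →
            (∃ ρ : ℝ, ∀ x : Kerr.region a r₀, (x : E4) 0 = F (E4.spatial (x : E4)) →
                ρ < E4.spatialNorm (x : E4) → ψ x = 0 ∧ mfderiv 𝓘(ℝ, E4) 𝓘(ℝ, ℝ) ψ x = 0) →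
            ∃ w : Fin m → E4 → ℝ,
              (∀ i, ContDiff ℝ 2 (w i)) ∧
              (∀ i x, w i x ≠ 0 →
                Kerr.rPlus M a + η / 4 ≤ Kerr.radius a x ∧ Kerr.radius a x ≤ R₂ + 1) ∧
              (∀ x : Kerr.exterior M a, Kerr.rPlus M a + η / 2 < Kerr.radius a (x : E4) →
                Kerr.radius a (x : E4) < R₂ → F (E4.spatial (x : E4)) < (x : E4) 0 →
                ∑ i, w i x = ψ ⟨(x : E4), Kerr.region_mono a hr.le x.2⟩) ∧
              (∀ i, ∫⁻ s in Set.Ioi 0, ∫⁻ y, ENNReal.ofReal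
                (∑ μ, fderiv ℝ (w i) (E4.ofTimeSpace (s + F y) y) (E4.basisVector μ) ^ 2) < ⊤) ∧
              (∀ i, ∫⁻ s in Set.Ioi 0, ∫⁻ y,
                {y : E3 | Kerr.radius a (E4.ofTimeSpace (s + F y) y) ∉ Set.Ioo (lo i) (hi i)}.indicator
                  (fun y ↦ ENNReal.ofReal
                    (∑ μ, fderiv ℝ (w i) (E4.ofTimeSpace (s + F y) y) (E4.basisVector μ) ^ 2)) y ≤
                B * graphSliceEnergy (Kerr.exterior M a)
                  (fun y : Kerr.exterior M a ↦ ψ ⟨(y : E4), Kerr.region_mono a hr.le y.2⟩) F 0) ∧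
              (∀ i, ∫⁻ s in Set.Ioi 0, ∫⁻ y, ENNReal.ofReal
                (KerrSchild.waveOperator (Kerr.inverseMetric M a) (w i)
                  (E4.ofTimeSpace (s + F y) y) ^ 2) ≤
                B * graphSliceEnergy (Kerr.exterior M a)
                  (fun y : Kerr.exterior M a ↦ ψ ⟨(y : E4), Kerr.region_mono a hr.le y.2⟩) F 0) ∧
              (∀ i x, lo i < Kerr.radius a x → Kerr.radius a x < hi i →
                KerrSchild.waveOperator (Kerr.inverseMetric M a) (w i) x = 0))) :
    DafermosRodnianskiShlapentokhRothman2016_energyBoundedness_horizonRegular := by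
  refine DafermosRodnianskiShlapentokhRothman2016_energyBoundedness_horizonRegular_of_shellDecay_of_middleBound
    fun M a r₀ hr hMa hrm η₀ hη₀ ↦ ?_
  obtain ⟨η, hη, hηle, R₁, R₂, hR₁, hR, F, hF, h₁, h₂, h₃⟩ := h M a r₀ hr hMa hrm η₀ hη₀
  refine ⟨η, hη, hηle, R₁, R₂, hR₁, hR, F, hF, h₁, h₂, ?_⟩
  -- the middle bound from the trapped decompositions
  have hA₀ : Kerr.rPlus M a < Kerr.rPlus M a + η / 4 := by linarith
  obtain ⟨ε₀, hε₀, hmid⟩ := kerr_horizonRegular_middleBound_of_trappedDecomposition hMa hr.le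
    (A₀ := Kerr.rPlus M a + η / 4) (A₁ := R₂ + 1) (A₀' := Kerr.rPlus M a + η / 2) (A₁' := R₂) hA₀ hF
  obtain ⟨m, lo, hi, hsh, B, hB, hpack⟩ := h₃ ε₀ hε₀
  obtain ⟨C, hC, hbound⟩ := hmid m lo hi hsh B hB
  refine ⟨C, hC, fun ψ hψ hwave hdata τ hτ ↦ ?_⟩
  obtain ⟨w, hw, hsupp, hP1, hP3, hP4, hP5, hP6⟩ := hpack ψ hψ hwave hdata
  exact hbound ψ w hw hsupp hP1 hP3 hP4 hP5 hP6 τ hτ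

/-! ## Collar decay from the pieces, and the reduction to trapped-set decompositions alone -/

/-- **Integrated decay of the energy on a collar off the shells, from a trapped-set decomposition**
(Dafermos–Rodnianski–Shlapentokh-Rothman arXiv:1402.7034, §13.1.2–§13.2: the integrated local
energy decay of `ψ` on the collars `[A₀ + δ, A₀ + 2δ]`, `[A₁ − 2δ, A₁ − δ]` off the trapped set, here
read off from the pieces). Let `w_i ∈ C²(ℝ⁴)` with (P1) `∑_i w_i = ψ` at the exterior points with
`A₀' < r < A₁'` in the future of `Σ̃_0 = {t* = F}` and (P4)
`∫_0^∞ ∫_{r ∉ (lo_i, hi_i)} ∑_μ (∂_μ w_i)² ≤ B E(0)`, and let `[c₀, c₁] ⊆ (A₀', A₁')` be a collar met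
by none of the open shells `(lo_i, hi_i)`. THEN
`∫_{(0,τ]} E(u; {c₀ ≤ r ≤ c₁}) du ≤ m² B E(0)`, `E(u; S)` the coordinate energy of `ψ|_{r > r₊}`
through `Σ̃_u = {t* = u + F}` on `S` (`graphSliceEnergyOn`): on the collar
`∑_μ (∂_μ ψ)² = ∑_μ (∂_μ ∑_i w_i)² ≤ m ∑_i ∑_μ (∂_μ w_i)²` and `r ∉ (lo_i, hi_i)` for every `i`.
[cite: DafermosRodnianskiShlapentokhrothman2014, §13.2 with (13.1.2)] -/
theorem kerr_graphSlice_collarDecay_of_trappedDecomposition {M a r₀ : ℝ}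
    (hr : r₀ ≤ Kerr.rPlus M a) {A₀' A₁' c₀ c₁ : ℝ} (hc₀ : A₀' < c₀) (hc₁ : c₁ < A₁')
    {F : E3 → ℝ} (hFc : Continuous F) {m : ℕ} {lo hi : Fin m → ℝ}
    (hsh : ∀ i, hi i ≤ c₀ ∨ c₁ ≤ lo i) (ψ : Kerr.region a r₀ → ℝ) {w : Fin m → E4 → ℝ}
    (hw : ∀ i, ContDiff ℝ 2 (w i))
    (hP1 : ∀ x : Kerr.exterior M a, A₀' < Kerr.radius a (x : E4) → Kerr.radius a (x : E4) < A₁' →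
      F (E4.spatial (x : E4)) < (x : E4) 0 →
      ∑ i, w i x = ψ ⟨(x : E4), Kerr.region_mono a hr x.2⟩)
    {B : ℝ≥0∞}
    (hP4 : ∀ i, ∫⁻ s in Set.Ioi 0, ∫⁻ y,
      {y : E3 | Kerr.radius a (E4.ofTimeSpace (s + F y) y) ∉ Set.Ioo (lo i) (hi i)}.indicator
        (fun y ↦ ENNReal.ofReal
          (∑ μ, fderiv ℝ (w i) (E4.ofTimeSpace (s + F y) y) (E4.basisVector μ) ^ 2)) y ≤
      B * graphSliceEnergy (Kerr.exterior M a)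
        (fun y : Kerr.exterior M a ↦ ψ ⟨(y : E4), Kerr.region_mono a hr y.2⟩) F 0)
    (τ : ℝ) :
    ∫⁻ u in Set.Ioc 0 τ, graphSliceEnergyOn (Kerr.exterior M a)
        (fun y : Kerr.exterior M a ↦ ψ ⟨(y : E4), Kerr.region_mono a hr y.2⟩) F u
        {y | c₀ ≤ Kerr.radius a (E4.ofTimeSpace (u + F y) y) ∧
          Kerr.radius a (E4.ofTimeSpace (u + F y) y) ≤ c₁} ≤
      (m : ℝ≥0∞) * ((m : ℝ≥0∞) * (B * graphSliceEnergy (Kerr.exterior M a)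
        (fun y : Kerr.exterior M a ↦ ψ ⟨(y : E4), Kerr.region_mono a hr y.2⟩) F 0)) := by
  set ψ' : Kerr.exterior M a → ℝ := fun y ↦ ψ ⟨(y : E4), Kerr.region_mono a hr y.2⟩ with hψ'
  set E0 : ℝ≥0∞ := graphSliceEnergy (Kerr.exterior M a) ψ' F 0 with hE0
  set p2 : Fin m → E4 → ℝ := fun i x ↦ ∑ μ, fderiv ℝ (w i) x (E4.basisVector μ) ^ 2 with hp2
  set ind : Fin m → ℝ × E3 → ℝ≥0∞ := fun i q ↦
    {q : ℝ × E3 | Kerr.radius a (E4.ofTimeSpace (q.1 + F q.2) q.2) ∉ Set.Ioo (lo i) (hi i)}.indicator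
      (fun q ↦ ENNReal.ofReal (p2 i (E4.ofTimeSpace (q.1 + F q.2) q.2))) q with hind
  have hind_eq : ∀ i (u : ℝ) (y : E3),
      {y : E3 | Kerr.radius a (E4.ofTimeSpace (u + F y) y) ∉ Set.Ioo (lo i) (hi i)}.indicator
        (fun y ↦ ENNReal.ofReal (p2 i (E4.ofTimeSpace (u + F y) y))) y = ind i (u, y) := by
    intro i u y
    simp only [hind, Set.indicator_apply, Set.mem_setOf_eq]
  have hp2nn : ∀ i x, 0 ≤ p2 i x := fun i x ↦ Finset.sum_nonneg fun μ _ ↦ sq_nonneg _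
  have hpdc : ∀ i κ, Continuous fun x ↦ fderiv ℝ (w i) x (E4.basisVector κ) := fun i κ ↦
    (KerrSchild.contDiff_fderiv_apply_basisVector (hw i) κ).continuous
  have hp2c : ∀ i, Continuous (p2 i) := fun i ↦ continuous_finsetSum _ fun μ _ ↦ (hpdc i μ).pow 2
  have hgraph2 : Continuous fun q : ℝ × E3 ↦ E4.ofTimeSpace (q.1 + F q.2) q.2 :=
    E4.continuous_ofTimeSpace' (continuous_fst.add (hFc.comp continuous_snd)) continuous_snd
  have hrad2 : Continuous fun q : ℝ × E3 ↦ Kerr.radius a (E4.ofTimeSpace (q.1 + F q.2) q.2) :=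
    (Kerr.continuous_radius a).comp hgraph2
  have hind_meas : ∀ i, Measurable (ind i) := by
    intro i
    have hset : MeasurableSet
        {q : ℝ × E3 | Kerr.radius a (E4.ofTimeSpace (q.1 + F q.2) q.2) ∉ Set.Ioo (lo i) (hi i)} :=
      (isOpen_Ioo.preimage hrad2).measurableSet.compl
    have hf : Measurable fun q : ℝ × E3 ↦
        ENNReal.ofReal (p2 i (E4.ofTimeSpace (q.1 + F q.2) q.2)) :=
      ((hp2c i).comp hgraph2).measurable.ennreal_ofReal
    exact hf.indicator hset
  have hind_y : ∀ i (u : ℝ), Measurable fun y : E3 ↦ ind i (u, y) := fun i u ↦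
    (hind_meas i).comp measurable_prodMk_left
  have hind_u : ∀ i, Measurable fun u : ℝ ↦ ∫⁻ y, ind i (u, y) := fun i ↦
    (hind_meas i).lintegral_prod_right'
  -- ### the pointwise bound on the collar, in the future of `Σ̃_0`
  set Φ' : E4 → ℝ := Function.extend Subtype.val ψ' 0 with hΦ'
  set O : Set E4 := {x | x ∈ (Kerr.exterior M a : Set E4) ∧ A₀' < Kerr.radius a x ∧
    Kerr.radius a x < A₁' ∧ F (E4.spatial x) < x 0} with hO
  have hOopen : IsOpen O := by
    rw [hO, Set.setOf_and, Set.setOf_and, Set.setOf_and]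
    refine (Kerr.exterior M a).isOpen.inter ((isOpen_lt continuous_const (Kerr.continuous_radius a)).inter
      ((isOpen_lt (Kerr.continuous_radius a) continuous_const).inter ?_))
    exact isOpen_lt (hFc.comp E4.spatial.continuous) (E4.dx 0).continuous
  have hOeq : ∀ x ∈ O, Φ' x = ∑ i, w i x := by
    intro x hx
    have h := hP1 ⟨x, hx.1⟩ hx.2.1 hx.2.2.1 hx.2.2.2
    rw [hΦ', ← extend_rep ψ' ⟨x, hx.1⟩]
    exact h.symm
  have hfd : ∀ z ∈ O, fderiv ℝ Φ' z = ∑ i, fderiv ℝ (w i) z := by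
    intro z hz
    have hev : Φ' =ᶠ[𝓝 z] fun x ↦ ∑ i, w i x := Filter.eventually_of_mem (hOopen.mem_nhds hz) hOeq
    rw [hev.fderiv_eq]
    exact fderiv_fun_sum fun i _ ↦ ((hw i).differentiable two_ne_zero) z
  have hpt : ∀ u : ℝ, 0 < u → ∀ y : E3,
      c₀ ≤ Kerr.radius a (E4.ofTimeSpace (u + F y) y) →
      Kerr.radius a (E4.ofTimeSpace (u + F y) y) ≤ c₁ →
      {y : E3 | E4.ofTimeSpace (u + F y) y ∈ Kerr.exterior M a}.indicator
        (fun y ↦ ENNReal.ofReal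
          (coordEnergyDensity (Kerr.exterior M a) ψ' (E4.ofTimeSpace (u + F y) y))) y ≤
        (m : ℝ≥0∞) * ∑ i, ind i (u, y) := by
    intro u hu y hy₀ hy₁
    set z := E4.ofTimeSpace (u + F y) y with hz
    by_cases hzU : y ∈ {y : E3 | E4.ofTimeSpace (u + F y) y ∈ Kerr.exterior M a}
    · rw [Set.indicator_of_mem hzU]
      have hzext : z ∈ (Kerr.exterior M a : Set E4) := hzU
      have hzO : z ∈ O := by
        refine ⟨hzext, by linarith, by linarith, ?_⟩
        simp only [hz, E4.spatial_ofTimeSpace, E4.ofTimeSpace_apply_zero]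
        linarith
      rw [← Kerr.sum_sq_fderiv_extend_eq, hfd z hzO]
      have h1 : ∀ μ, ((∑ i, fderiv ℝ (w i) z) (E4.basisVector μ)) ^ 2 ≤
          (m : ℝ) * ∑ i, (fderiv ℝ (w i) z (E4.basisVector μ)) ^ 2 := by
        intro μ
        have h := sq_sum_le_card_mul_sum_sq (s := (Finset.univ : Finset (Fin m)))
          (f := fun i ↦ fderiv ℝ (w i) z (E4.basisVector μ))
        simp only [Finset.card_univ, Fintype.card_fin] at h
        rw [FunLike.coe_sum, Finset.sum_apply]
        exact h
      have hcs : ∑ μ, ((∑ i, fderiv ℝ (w i) z) (E4.basisVector μ)) ^ 2 ≤ (m : ℝ) * ∑ i, p2 i z := by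
        calc ∑ μ, ((∑ i, fderiv ℝ (w i) z) (E4.basisVector μ)) ^ 2
            ≤ ∑ μ, (m : ℝ) * ∑ i, (fderiv ℝ (w i) z (E4.basisVector μ)) ^ 2 :=
              Finset.sum_le_sum fun μ _ ↦ h1 μ
          _ = (m : ℝ) * ∑ i, p2 i z := by
              rw [← Finset.mul_sum, Finset.sum_comm]
      -- on the collar every piece is off its shell
      have hoff : ∀ i, ind i (u, y) = ENNReal.ofReal (p2 i z) := by
        intro i
        have hmem : (u, y) ∈ {q : ℝ × E3 |
            Kerr.radius a (E4.ofTimeSpace (q.1 + F q.2) q.2) ∉ Set.Ioo (lo i) (hi i)} := by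
          simp only [Set.mem_setOf_eq, Set.mem_Ioo, not_and_or, not_lt]
          rcases hsh i with h | h
          · exact Or.inr (h.trans hy₀)
          · exact Or.inl (hy₁.trans h)
        simp only [hind]
        rw [Set.indicator_of_mem hmem]
      calc ENNReal.ofReal (∑ μ, ((∑ i, fderiv ℝ (w i) z) (E4.basisVector μ)) ^ 2)
          ≤ ENNReal.ofReal ((m : ℝ) * ∑ i, p2 i z) := ENNReal.ofReal_le_ofReal hcs
        _ = (m : ℝ≥0∞) * ∑ i, ENNReal.ofReal (p2 i z) := by
            rw [ENNReal.ofReal_mul (Nat.cast_nonneg m), ENNReal.ofReal_natCast,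
              ENNReal.ofReal_sum_of_nonneg (fun i _ ↦ hp2nn i z)]
        _ = (m : ℝ≥0∞) * ∑ i, ind i (u, y) := by
            congr 1
            exact Finset.sum_congr rfl fun i _ ↦ (hoff i).symm
    · rw [Set.indicator_of_notMem hzU]
      exact zero_le
  -- ### the bound on each leaf `u > 0`
  have hleaf : ∀ u : ℝ, 0 < u →
      graphSliceEnergyOn (Kerr.exterior M a) ψ' F u
        {y | c₀ ≤ Kerr.radius a (E4.ofTimeSpace (u + F y) y) ∧
          Kerr.radius a (E4.ofTimeSpace (u + F y) y) ≤ c₁} ≤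
        (m : ℝ≥0∞) * ∑ i, ∫⁻ y, ind i (u, y) := by
    intro u hu
    set S : Set E3 := {y | c₀ ≤ Kerr.radius a (E4.ofTimeSpace (u + F y) y) ∧
      Kerr.radius a (E4.ofTimeSpace (u + F y) y) ≤ c₁} with hSdef
    have hrc : Continuous fun y : E3 ↦ Kerr.radius a (E4.ofTimeSpace (u + F y) y) :=
      (Kerr.continuous_radius a).comp
        (E4.continuous_ofTimeSpace' (continuous_const.add hFc) continuous_id)
    have hS : MeasurableSet S := by
      rw [hSdef, Set.setOf_and]
      exact ((isClosed_le continuous_const hrc).inter (isClosed_le hrc continuous_const)).measurableSet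
    calc graphSliceEnergyOn (Kerr.exterior M a) ψ' F u S
        = ∫⁻ y in S, {y : E3 | E4.ofTimeSpace (u + F y) y ∈ Kerr.exterior M a}.indicator
            (fun y ↦ ENNReal.ofReal
              (coordEnergyDensity (Kerr.exterior M a) ψ' (E4.ofTimeSpace (u + F y) y))) y := rfl
      _ ≤ ∫⁻ y in S, (m : ℝ≥0∞) * ∑ i, ind i (u, y) :=
          setLIntegral_mono' hS fun y hy ↦ hpt u hu y hy.1 hy.2
      _ ≤ ∫⁻ y, (m : ℝ≥0∞) * ∑ i, ind i (u, y) := setLIntegral_le_lintegral _ _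
      _ = (m : ℝ≥0∞) * ∑ i, ∫⁻ y, ind i (u, y) := by
          rw [lintegral_const_mul' _ _ (ENNReal.natCast_ne_top m),
            lintegral_finsetSum _ (fun i _ ↦ hind_y i u)]
  -- ### integrate in `u ∈ (0, τ]`
  have hP4' : ∀ i, ∫⁻ u in Set.Ioi 0, ∫⁻ y, ind i (u, y) ≤ B * E0 := by
    intro i
    have h1 : (fun u : ℝ ↦ ∫⁻ y, ind i (u, y)) = fun u ↦ ∫⁻ y,
        {y : E3 | Kerr.radius a (E4.ofTimeSpace (u + F y) y) ∉ Set.Ioo (lo i) (hi i)}.indicator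
          (fun y ↦ ENNReal.ofReal (p2 i (E4.ofTimeSpace (u + F y) y))) y := by
      funext u
      exact lintegral_congr fun y ↦ (hind_eq i u y).symm
    rw [h1]
    exact hP4 i
  calc ∫⁻ u in Set.Ioc 0 τ, graphSliceEnergyOn (Kerr.exterior M a) ψ' F u
          {y | c₀ ≤ Kerr.radius a (E4.ofTimeSpace (u + F y) y) ∧
            Kerr.radius a (E4.ofTimeSpace (u + F y) y) ≤ c₁}
      ≤ ∫⁻ u in Set.Ioc 0 τ, (m : ℝ≥0∞) * ∑ i, ∫⁻ y, ind i (u, y) :=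
        setLIntegral_mono' measurableSet_Ioc fun u hu ↦ hleaf u hu.1
    _ = (m : ℝ≥0∞) * ∑ i, ∫⁻ u in Set.Ioc 0 τ, ∫⁻ y, ind i (u, y) := by
        rw [lintegral_const_mul' _ _ (ENNReal.natCast_ne_top m),
          lintegral_finsetSum _ (fun i _ ↦ hind_u i)]
    _ ≤ (m : ℝ≥0∞) * ∑ i, ∫⁻ u in Set.Ioi 0, ∫⁻ y, ind i (u, y) :=
        mul_le_mul' le_rfl (Finset.sum_le_sum fun i _ ↦ lintegral_mono_set Set.Ioc_subset_Ioi_self)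
    _ ≤ (m : ℝ≥0∞) * ∑ _i : Fin m, B * E0 :=
        mul_le_mul' le_rfl (Finset.sum_le_sum fun i _ ↦ hP4' i)
    _ = (m : ℝ≥0∞) * ((m : ℝ≥0∞) * (B * E0)) := by
        rw [Finset.sum_const, Finset.card_univ, Fintype.card_fin, nsmul_eq_mul]

/-- **Energy boundedness for horizon-regular solutions from trapped-set decompositions alone**
(Dafermos–Rodnianski–Shlapentokh-Rothman arXiv:1402.7034, Thm. 3.1 (23), §3.3 form,
horizon-regular class): the named fact
`DafermosRodnianskiShlapentokhRothman2016_energyBoundedness_horizonRegular` follows once, for every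
subextremal `(M, a)`, `r₋ < r₀ < r₊` and `η₀ > 0`, there are `0 < η ≤ η₀`, radii
`r₊ + η < R₁ < R₂` with `2M < R₁`, ONE admissible height `F`, and for every `ε₀ > 0` an `ε₀`-fine
finite family of radial shells inside `[r₊ + η, R₁]` and `B < ∞` such that every horizon-regular
solution `ψ` admits functions `w_i ∈ C²(ℝ⁴)` supported in `{r₊ + η/8 ≤ r ≤ R₂ + 2}` with
(P1) `∑_i w_i = ψ` at the exterior points with `r₊ + η/4 < r < R₂ + 1` in the future of `Σ̃_0`,
(P3) `∫_0^∞ ∫ ∑_μ(∂_μ w_i)² < ∞`, (P4) `∫_0^∞ ∫_{r ∉ (lo_i, hi_i)} ∑_μ(∂_μ w_i)² ≤ B E(0)`,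
(P5) `∫_0^∞ ∫ (□_g w_i)² ≤ B E(0)`, (P6) `□_g w_i = 0` on `{lo_i < r < hi_i}` — the pieces
`ψ̃_i = 𝒫_{𝒞_i}(χψ)` of loc. cit. Def. 13.1.2 with the phase-space integrated decay (notCrudeILED)
and Plancherel. Compared with
`DafermosRodnianskiShlapentokhRothman2016_energyBoundedness_horizonRegular_of_shellDecay_of_trappedDecomposition`
the integrated decay of the energy on the near-horizon collar `[r₊ + η/2, r₊ + η]` and on the far
collar `[R₁, R₂]` (hypotheses (i), (ii) of the §13.3 assembly) is no longer assumed: both collars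
lie in the region of (P1) and off every shell, so it follows from (P4)
(`kerr_graphSlice_collarDecay_of_trappedDecomposition`); the middle bound is
`kerr_horizonRegular_middleBound_of_trappedDecomposition` (Props. 13.1.1–13.1.2). The hypothesis
is the phase-space theory of §§5–12 with §13.1.1–§13.1.2 of loc. cit.; it is NOT proved in this
library. [cite: DafermosRodnianskiShlapentokhrothman2014, Thm. 3.1 (23), §13] -/
theorem DafermosRodnianskiShlapentokhRothman2016_energyBoundedness_horizonRegular_of_trappedDecomposition
    (h : ∀ [Kerr.Facts] [Kerr.SliceFacts] (M a r₀ : ℝ) (hr : r₀ < Kerr.rPlus M a),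
      Kerr.IsSubextremal M a → Kerr.rMinus M a < r₀ → ∀ η₀ : ℝ, 0 < η₀ →
      ∃ η : ℝ, 0 < η ∧ η ≤ η₀ ∧ ∃ R₁ R₂ : ℝ, 2 * M < R₁ ∧ Kerr.rPlus M a + η < R₁ ∧ R₁ < R₂ ∧
      ∃ F : E3 → ℝ, Kerr.IsAdmissibleHeight M F ∧
        ∀ ε₀ : ℝ, 0 < ε₀ → ∃ (m : ℕ) (lo hi : Fin m → ℝ),
          (∀ i, Kerr.rPlus M a + η ≤ lo i ∧ lo i ≤ hi i ∧ hi i ≤ R₁ ∧ hi i - lo i ≤ ε₀) ∧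
          ∃ B : ℝ≥0∞, B < ⊤ ∧ ∀ ψ : Kerr.region a r₀ → ℝ,
          ContMDiff 𝓘(ℝ, E4) 𝓘(ℝ, ℝ) ∞ ψ →
          (∀ x : Kerr.region a r₀, Kerr.rPlus M a < Kerr.radius a (x : E4) →
            (Kerr.smoothMetric M a r₀).toPseudoRiemannianMetric.dalembertian ψ x = 0) →
          (∃ ρ : ℝ, ∀ x : Kerr.region a r₀, (x : E4) 0 = F (E4.spatial (x : E4)) →
              ρ < E4.spatialNorm (x : E4) → ψ x = 0 ∧ mfderiv 𝓘(ℝ, E4) 𝓘(ℝ, ℝ) ψ x = 0) →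
          ∃ w : Fin m → E4 → ℝ,
            (∀ i, ContDiff ℝ 2 (w i)) ∧
            (∀ i x, w i x ≠ 0 →
              Kerr.rPlus M a + η / 8 ≤ Kerr.radius a x ∧ Kerr.radius a x ≤ R₂ + 2) ∧
            (∀ x : Kerr.exterior M a, Kerr.rPlus M a + η / 4 < Kerr.radius a (x : E4) →
              Kerr.radius a (x : E4) < R₂ + 1 → F (E4.spatial (x : E4)) < (x : E4) 0 →
              ∑ i, w i x = ψ ⟨(x : E4), Kerr.region_mono a hr.le x.2⟩) ∧
            (∀ i, ∫⁻ s in Set.Ioi 0, ∫⁻ y, ENNReal.ofReal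
              (∑ μ, fderiv ℝ (w i) (E4.ofTimeSpace (s + F y) y) (E4.basisVector μ) ^ 2) < ⊤) ∧
            (∀ i, ∫⁻ s in Set.Ioi 0, ∫⁻ y,
              {y : E3 | Kerr.radius a (E4.ofTimeSpace (s + F y) y) ∉ Set.Ioo (lo i) (hi i)}.indicator
                (fun y ↦ ENNReal.ofReal
                  (∑ μ, fderiv ℝ (w i) (E4.ofTimeSpace (s + F y) y) (E4.basisVector μ) ^ 2)) y ≤
              B * graphSliceEnergy (Kerr.exterior M a)
                (fun y : Kerr.exterior M a ↦ ψ ⟨(y : E4), Kerr.region_mono a hr.le y.2⟩) F 0) ∧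
            (∀ i, ∫⁻ s in Set.Ioi 0, ∫⁻ y, ENNReal.ofReal
              (KerrSchild.waveOperator (Kerr.inverseMetric M a) (w i)
                (E4.ofTimeSpace (s + F y) y) ^ 2) ≤
              B * graphSliceEnergy (Kerr.exterior M a)
                (fun y : Kerr.exterior M a ↦ ψ ⟨(y : E4), Kerr.region_mono a hr.le y.2⟩) F 0) ∧
            (∀ i x, lo i < Kerr.radius a x → Kerr.radius a x < hi i →
              KerrSchild.waveOperator (Kerr.inverseMetric M a) (w i) x = 0)) :
    DafermosRodnianskiShlapentokhRothman2016_energyBoundedness_horizonRegular := by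
  refine DafermosRodnianskiShlapentokhRothman2016_energyBoundedness_horizonRegular_of_shellDecay_of_middleBound
    fun M a r₀ hr hMa hrm η₀ hη₀ ↦ ?_
  obtain ⟨η, hη, hηle, R₁, R₂, hR₁, hηR₁, hR, F, hF, hpk⟩ := h M a r₀ hr hMa hrm η₀ hη₀
  -- the timelikeness margin of the vector fields `V_i` fixes the width of the shells
  have hA₀ : Kerr.rPlus M a < Kerr.rPlus M a + η / 8 := by linarith
  obtain ⟨ε₀, hε₀, hmid⟩ := kerr_horizonRegular_middleBound_of_trappedDecomposition hMa hr.le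
    (A₀ := Kerr.rPlus M a + η / 8) (A₁ := R₂ + 2) (A₀' := Kerr.rPlus M a + η / 4) (A₁' := R₂ + 1)
    hA₀ hF
  obtain ⟨m, lo, hi, hsh, B, hB, hpack⟩ := hpk ε₀ hε₀
  have hsh' : ∀ i, Kerr.rPlus M a + η / 8 ≤ lo i ∧ lo i ≤ hi i ∧ hi i ≤ R₂ + 2 ∧ hi i - lo i ≤ ε₀ := by
    intro i
    obtain ⟨h1, h2, h3, h4⟩ := hsh i
    exact ⟨by linarith, h2, by linarith, h4⟩
  obtain ⟨C, hC, hbound⟩ := hmid m lo hi hsh' B hB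
  have hFc : Continuous F := hF.contDiff.continuous
  have hmB : (m : ℝ≥0∞) * ((m : ℝ≥0∞) * B) < ⊤ :=
    ENNReal.mul_lt_top (ENNReal.natCast_lt_top m) (ENNReal.mul_lt_top (ENNReal.natCast_lt_top m) hB)
  refine ⟨η, hη, hηle, R₁, R₂, hR₁, hR, F, hF, ⟨_, hmB, fun ψ hψ hwave hdata τ _ ↦ ?_⟩,
    ⟨_, hmB, fun ψ hψ hwave hdata τ _ ↦ ?_⟩, ⟨C, hC, fun ψ hψ hwave hdata τ hτ ↦ ?_⟩⟩
  · -- (i) the near-horizon collar `[r₊ + η/2, r₊ + η]`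
    obtain ⟨w, hw, -, hP1, -, hP4, -, -⟩ := hpack ψ hψ hwave hdata
    have hc₀ : Kerr.rPlus M a + η / 4 < Kerr.rPlus M a + η / 2 := by linarith
    have hc₁ : Kerr.rPlus M a + η < R₂ + 1 := by linarith
    have key := kerr_graphSlice_collarDecay_of_trappedDecomposition hr.le hc₀ hc₁ hFc
      (lo := lo) (hi := hi) (fun i ↦ Or.inr (hsh i).1) ψ hw hP1 hP4 τ
    calc _ ≤ _ := key
      _ = (m : ℝ≥0∞) * ((m : ℝ≥0∞) * B) * graphSliceEnergy (Kerr.exterior M a)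
            (fun y : Kerr.exterior M a ↦ ψ ⟨(y : E4), Kerr.region_mono a hr.le y.2⟩) F 0 := by ring
  · -- (ii) the far collar `[R₁, R₂]`
    obtain ⟨w, hw, -, hP1, -, hP4, -, -⟩ := hpack ψ hψ hwave hdata
    have hc₀ : Kerr.rPlus M a + η / 4 < R₁ := by linarith
    have hc₁ : R₂ < R₂ + 1 := by linarith
    have key := kerr_graphSlice_collarDecay_of_trappedDecomposition hr.le hc₀ hc₁ hFc
      (lo := lo) (hi := hi) (fun i ↦ Or.inl (hsh i).2.2.1) ψ hw hP1 hP4 τ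
    calc _ ≤ _ := key
      _ = (m : ℝ≥0∞) * ((m : ℝ≥0∞) * B) * graphSliceEnergy (Kerr.exterior M a)
            (fun y : Kerr.exterior M a ↦ ψ ⟨(y : E4), Kerr.region_mono a hr.le y.2⟩) F 0 := by ring
  · -- (iii) the middle region `{r₊ + η/2 < r < R₂} ⊆ {r₊ + η/4 < r < R₂ + 1}`
    obtain ⟨w, hw, hsupp, hP1, hP3, hP4, hP5, hP6⟩ := hpack ψ hψ hwave hdata
    refine le_trans (graphSliceEnergyOn_mono _ _ _ _ fun y hy ↦ ?_)
      (hbound ψ w hw hsupp hP1 hP3 hP4 hP5 hP6 τ hτ)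
    simp only [Set.mem_setOf_eq] at hy ⊢
    exact ⟨by linarith [hy.1], by linarith [hy.2]⟩

/-! ## Space-time form of the package -/

/-- **Leaf integrals over the future of `Σ̃_0` are space-time integrals** (the case `S = (0, ∞)`,
`B = E3` of `Kerr.lintegral_lintegral_leafPoint_eq`): for a measurable height `F` and a measurable
`G : ℝ⁴ → [0, ∞]`, `∫_{s > 0} ∫_{E3} G(s + F(y), y) dy ds = ∫_{{x | F(x⃗) < x⁰}} G dVol` — the region
`D⁺(Σ̃_0) = {t* > F}` swept by the leaves `Σ̃_s = {t* = s + F}`, `s > 0`, carries `dt* dy`, the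
metric volume of the Kerr–Schild chart (`det g = −1`). [folklore] -/
theorem kerr_lintegral_Ioi_lintegral_leaf_eq {F : E3 → ℝ} (hF : Measurable F) {G : E4 → ℝ≥0∞}
    (hG : Measurable G) :
    ∫⁻ s in Set.Ioi 0, ∫⁻ y, G (E4.ofTimeSpace (s + F y) y) =
      ∫⁻ x in {x : E4 | F (E4.spatial x) < x 0}, G x := by
  have h := Kerr.lintegral_lintegral_leafPoint_eq hF hG (measurableSet_Ioi (a := (0 : ℝ)))
    MeasurableSet.univ
  simp only [Measure.restrict_univ, Set.mem_univ, true_and, Set.mem_Ioi, sub_pos] at h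
  exact h

/-- **Energy boundedness for horizon-regular solutions from trapped-set decompositions, space-time
form** (Dafermos–Rodnianski–Shlapentokh-Rothman arXiv:1402.7034, Thm. 3.1 (23), §3.3 form,
horizon-regular class). The same reduction as
`DafermosRodnianskiShlapentokhRothman2016_energyBoundedness_horizonRegular_of_trappedDecomposition`,
with the integrability and the bounds (P3)–(P5) on the pieces `w_i` written as space-time
integrals over the future `D⁺(Σ̃_0) = {x | F(x⃗) < x⁰}` of the initial leaf with respect to the
Lebesgue measure `dt* dy` of the Kerr–Schild chart (= the metric volume, `det g = −1`) — the
currency of the Plancherel identities of loc. cit. §5 — instead of iterated integrals over the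
leaves `Σ̃_s`, `s > 0` (`kerr_lintegral_Ioi_lintegral_leaf_eq`):
(P3') `∫_{t* > F} ∑_μ (∂_μ w_i)² dVol < ∞`; (P4') `∫_{t* > F, r ∉ (lo_i, hi_i)} ∑_μ (∂_μ w_i)² dVol ≤ B E(0)`;
(P5') `∫_{t* > F} (□_g w_i)² dVol ≤ B E(0)`. The hypothesis is the phase-space theory of §§5–12
with §13.1.1–§13.1.2 of loc. cit.; it is NOT proved in this library.
[cite: DafermosRodnianskiShlapentokhrothman2014, Thm. 3.1 (23), §13] -/
theorem DafermosRodnianskiShlapentokhRothman2016_energyBoundedness_horizonRegular_of_trappedDecomposition_spacetime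
    (h : ∀ [Kerr.Facts] [Kerr.SliceFacts] (M a r₀ : ℝ) (hr : r₀ < Kerr.rPlus M a),
      Kerr.IsSubextremal M a → Kerr.rMinus M a < r₀ → ∀ η₀ : ℝ, 0 < η₀ →
      ∃ η : ℝ, 0 < η ∧ η ≤ η₀ ∧ ∃ R₁ R₂ : ℝ, 2 * M < R₁ ∧ Kerr.rPlus M a + η < R₁ ∧ R₁ < R₂ ∧
      ∃ F : E3 → ℝ, Kerr.IsAdmissibleHeight M F ∧
        ∀ ε₀ : ℝ, 0 < ε₀ → ∃ (m : ℕ) (lo hi : Fin m → ℝ),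
          (∀ i, Kerr.rPlus M a + η ≤ lo i ∧ lo i ≤ hi i ∧ hi i ≤ R₁ ∧ hi i - lo i ≤ ε₀) ∧
          ∃ B : ℝ≥0∞, B < ⊤ ∧ ∀ ψ : Kerr.region a r₀ → ℝ,
          ContMDiff 𝓘(ℝ, E4) 𝓘(ℝ, ℝ) ∞ ψ →
          (∀ x : Kerr.region a r₀, Kerr.rPlus M a < Kerr.radius a (x : E4) →
            (Kerr.smoothMetric M a r₀).toPseudoRiemannianMetric.dalembertian ψ x = 0) →
          (∃ ρ : ℝ, ∀ x : Kerr.region a r₀, (x : E4) 0 = F (E4.spatial (x : E4)) →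
              ρ < E4.spatialNorm (x : E4) → ψ x = 0 ∧ mfderiv 𝓘(ℝ, E4) 𝓘(ℝ, ℝ) ψ x = 0) →
          ∃ w : Fin m → E4 → ℝ,
            (∀ i, ContDiff ℝ 2 (w i)) ∧
            (∀ i x, w i x ≠ 0 →
              Kerr.rPlus M a + η / 8 ≤ Kerr.radius a x ∧ Kerr.radius a x ≤ R₂ + 2) ∧
            (∀ x : Kerr.exterior M a, Kerr.rPlus M a + η / 4 < Kerr.radius a (x : E4) →
              Kerr.radius a (x : E4) < R₂ + 1 → F (E4.spatial (x : E4)) < (x : E4) 0 →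
              ∑ i, w i x = ψ ⟨(x : E4), Kerr.region_mono a hr.le x.2⟩) ∧
            (∀ i, ∫⁻ x in {x : E4 | F (E4.spatial x) < x 0}, ENNReal.ofReal
              (∑ μ, fderiv ℝ (w i) x (E4.basisVector μ) ^ 2) < ⊤) ∧
            (∀ i, ∫⁻ x in {x : E4 | F (E4.spatial x) < x 0 ∧
                Kerr.radius a x ∉ Set.Ioo (lo i) (hi i)}, ENNReal.ofReal
              (∑ μ, fderiv ℝ (w i) x (E4.basisVector μ) ^ 2) ≤
              B * graphSliceEnergy (Kerr.exterior M a)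
                (fun y : Kerr.exterior M a ↦ ψ ⟨(y : E4), Kerr.region_mono a hr.le y.2⟩) F 0) ∧
            (∀ i, ∫⁻ x in {x : E4 | F (E4.spatial x) < x 0}, ENNReal.ofReal
              (KerrSchild.waveOperator (Kerr.inverseMetric M a) (w i) x ^ 2) ≤
              B * graphSliceEnergy (Kerr.exterior M a)
                (fun y : Kerr.exterior M a ↦ ψ ⟨(y : E4), Kerr.region_mono a hr.le y.2⟩) F 0) ∧
            (∀ i x, lo i < Kerr.radius a x → Kerr.radius a x < hi i →
              KerrSchild.waveOperator (Kerr.inverseMetric M a) (w i) x = 0)) :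
    DafermosRodnianskiShlapentokhRothman2016_energyBoundedness_horizonRegular := by
  refine DafermosRodnianskiShlapentokhRothman2016_energyBoundedness_horizonRegular_of_trappedDecomposition
    fun M a r₀ hr hMa hrm η₀ hη₀ ↦ ?_
  obtain ⟨η, hη, hηle, R₁, R₂, hR₁, hηR₁, hR, F, hF, hpk⟩ := h M a r₀ hr hMa hrm η₀ hη₀
  refine ⟨η, hη, hηle, R₁, R₂, hR₁, hηR₁, hR, F, hF, fun ε₀ hε₀ ↦ ?_⟩
  obtain ⟨m, lo, hi, hsh, B, hB, hpack⟩ := hpk ε₀ hε₀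
  refine ⟨m, lo, hi, hsh, B, hB, fun ψ hψ hwave hdata ↦ ?_⟩
  obtain ⟨w, hw, hsupp, hP1, hP3, hP4, hP5, hP6⟩ := hpack ψ hψ hwave hdata
  -- measurability of the height and of the densities
  have hFm : Measurable F := hF.contDiff.continuous.measurable
  have hA₀pos : 0 < Kerr.rPlus M a + η / 8 := by linarith [hMa.rPlus_pos]
  set p2 : Fin m → E4 → ℝ := fun i x ↦ ∑ μ, fderiv ℝ (w i) x (E4.basisVector μ) ^ 2 with hp2
  have hp2c : ∀ i, Continuous (p2 i) := fun i ↦ continuous_finsetSum _ fun μ _ ↦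
    (KerrSchild.contDiff_fderiv_apply_basisVector (hw i) μ).continuous.pow 2
  have hp2m : ∀ i, Measurable fun x ↦ ENNReal.ofReal (p2 i x) := fun i ↦
    (hp2c i).measurable.ennreal_ofReal
  have hboxm : ∀ i, Measurable fun x ↦ ENNReal.ofReal
      (KerrSchild.waveOperator (Kerr.inverseMetric M a) (w i) x ^ 2) := fun i ↦
    ((Kerr.continuous_waveOperator_of_support_slab M (hw i) hA₀pos (hsupp i)).1.pow 2
      ).measurable.ennreal_ofReal
  have hT : ∀ i, MeasurableSet {x : E4 | Kerr.radius a x ∉ Set.Ioo (lo i) (hi i)} := fun i ↦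
    (isOpen_Ioo.preimage (Kerr.continuous_radius a)).measurableSet.compl
  have hS : MeasurableSet {x : E4 | F (E4.spatial x) < x 0} :=
    measurableSet_lt (hFm.comp E4.spatial.continuous.measurable) (E4.dx 0).continuous.measurable
  refine ⟨w, hw, hsupp, hP1, fun i ↦ ?_, fun i ↦ ?_, fun i ↦ ?_, hP6⟩
  · -- (P3) from (P3')
    refine lt_of_eq_of_lt ?_ (hP3 i)
    exact kerr_lintegral_Ioi_lintegral_leaf_eq hFm (hp2m i)
  · -- (P4) from (P4'): the indicator of `{r ∉ (lo_i, hi_i)}` as a function on space-time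
    set G4 : E4 → ℝ≥0∞ := {x : E4 | Kerr.radius a x ∉ Set.Ioo (lo i) (hi i)}.indicator
      fun x ↦ ENNReal.ofReal (p2 i x) with hG4
    have hG4m : Measurable G4 := (hp2m i).indicator (hT i)
    have h1 : ∀ (s : ℝ) (y : E3),
        {y : E3 | Kerr.radius a (E4.ofTimeSpace (s + F y) y) ∉ Set.Ioo (lo i) (hi i)}.indicator
          (fun y ↦ ENNReal.ofReal
            (∑ μ, fderiv ℝ (w i) (E4.ofTimeSpace (s + F y) y) (E4.basisVector μ) ^ 2)) y =
          G4 (E4.ofTimeSpace (s + F y) y) := by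
      intro s y
      simp only [hG4, hp2, Set.indicator_apply, Set.mem_setOf_eq]
    calc ∫⁻ s in Set.Ioi 0, ∫⁻ y,
          {y : E3 | Kerr.radius a (E4.ofTimeSpace (s + F y) y) ∉ Set.Ioo (lo i) (hi i)}.indicator
            (fun y ↦ ENNReal.ofReal
              (∑ μ, fderiv ℝ (w i) (E4.ofTimeSpace (s + F y) y) (E4.basisVector μ) ^ 2)) y
        = ∫⁻ s in Set.Ioi 0, ∫⁻ y, G4 (E4.ofTimeSpace (s + F y) y) :=
          lintegral_congr fun s ↦ lintegral_congr fun y ↦ h1 s y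
      _ = ∫⁻ x in {x : E4 | F (E4.spatial x) < x 0}, G4 x :=
          kerr_lintegral_Ioi_lintegral_leaf_eq hFm hG4m
      _ = ∫⁻ x in {x : E4 | F (E4.spatial x) < x 0 ∧ Kerr.radius a x ∉ Set.Ioo (lo i) (hi i)},
            ENNReal.ofReal (p2 i x) := by
          rw [hG4, lintegral_indicator (hT i), Measure.restrict_restrict (hT i), Set.inter_comm]
          rfl
      _ ≤ _ := hP4 i
  · -- (P5) from (P5')
    refine le_of_eq_of_le ?_ (hP5 i)
    exact kerr_lintegral_Ioi_lintegral_leaf_eq hFm (hboxm i)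

end Literature.Geometry.Lorentzian
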